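import Mathlib
import HarnessLib

/-!
# Format C, design C∞: entrywise convergence ⟹ the uniform quadratic-form approximation of the limit wrapper

Route context: Fourier–Galerkin / Schur-complement certificates of Weil positivity on a window ("format C";
cell memo `run/shared/lean/pub/rh-explicit/rh-explicit-weil-10/FORMATC-DESIGN.md` §9.12.9; supporting
stmt-RiemannHypothesis-0098; seat rh-explicit-weil-10).  `WeilFormatCDeflatedFarLimit.sum_range_mul_mul_nonneg_of_certificate_deflated_limit`
asks, for every `ε > 0`, for a finite profile table at SOME cut-off `P` whose augmented Gram form (and correction form)
reproduces the limit object to within `ε·(Σ x_i² + Σ β_j²)` uniformly in `(x, β)`.  The analytic files of design C∞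
(`WeilFormatCWindowPolyProfile`, `WeilFormatCPolyWindow*`) deliver ENTRYWISE limits (`P → ∞`) of the finitely many
entries.  This file is the finite-dimensional bridge between the two:

* `abs_sum_sum_mul_mul_le` — `|Σ_i Σ_i' z_i z_i' D_{ii'}| ≤ δ·n·Σ z_i²` when `|D_{ii'}| ≤ δ` (`n` indices; Cauchy–Schwarz);
* `abs_blockQuadForm_le` — the two-block version for `Σ x x D₁ + 2Σ x β D₂ + Σ β β D₃`:
  `≤ 2δ(B + r)(Σ x² + Σ β²)`;
* `exists_blockQuadForm_approx` — if the three entry families converge entrywise along `atTop`, then for every `ε > 0`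
  there is `P₀` such that for all `P ≥ P₀` and all `(x, β)` the block quadratic form of the `P`-th family is within
  `ε(Σ x² + Σ β²)` of that of the limits — exactly the shape of the wrapper's `happrox` clauses.

Pure finite-dimensional algebra and filters; standard axioms; nothing Weil-specific; no RH claim.
-/

set_option autoImplicit false
-- `Summit.RiemannHypothesis.RiemannHypothesis.…` is the layout-mandated namespace (summit = problem name).
set_option linter.dupNamespace false

namespace Summit.RiemannHypothesis.RiemannHypothesis.Theorems.WeilFormatC

open Finset Filter Topology

/-! ## Quadratic forms with uniformly small entries -/

/-- `|Σ_i Σ_i' z_i z_i' D_{ii'}| ≤ δ · n · Σ_i z_i²` for an `n × n` family with `|D_{ii'}| ≤ δ`. -/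
theorem abs_sum_sum_mul_mul_le {n : ℕ} {D : Fin n → Fin n → ℝ} {δ : ℝ} (hD : ∀ i i', |D i i'| ≤ δ) (z : Fin n → ℝ) :
    |∑ i, ∑ i', z i * z i' * D i i'| ≤ δ * n * ∑ i, z i ^ 2 := by
  rcases Nat.eq_zero_or_pos n with hn | hn
  · subst hn
    simp
  have hδ : 0 ≤ δ := (abs_nonneg _).trans (hD ⟨0, hn⟩ ⟨0, hn⟩)
  calc |∑ i, ∑ i', z i * z i' * D i i'|
      ≤ ∑ i, |∑ i', z i * z i' * D i i'| := abs_sum_le_sum_abs _ _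
    _ ≤ ∑ i, ∑ i', |z i| * |z i'| * δ := by
        refine sum_le_sum fun i _ ↦ (abs_sum_le_sum_abs _ _).trans (sum_le_sum fun i' _ ↦ ?_)
        rw [abs_mul, abs_mul]
        exact mul_le_mul_of_nonneg_left (hD i i') (by positivity)
    _ = δ * (∑ i, |z i|) ^ 2 := by
        rw [sq, sum_mul_sum, mul_sum]
        refine sum_congr rfl fun i _ ↦ ?_
        rw [mul_sum]
        exact sum_congr rfl fun i' _ ↦ by ring
    _ ≤ δ * (n * ∑ i, z i ^ 2) := by
        refine mul_le_mul_of_nonneg_left ?_ hδ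
        have h := sq_sum_le_card_mul_sum_sq (s := (univ : Finset (Fin n))) (f := fun i ↦ |z i|)
        simp only [card_univ, Fintype.card_fin, sq_abs] at h
        exact h
    _ = δ * n * ∑ i, z i ^ 2 := by ring

/-- `|2 Σ_i Σ_j x_i β_j D_{ij}| ≤ δ (B Σ x_i² + r Σ β_j²)` for a `B × r` family with `|D_{ij}| ≤ δ`. -/
theorem abs_two_mul_sum_sum_mul_mul_le {B r : ℕ} {D : Fin B → Fin r → ℝ} {δ : ℝ} (hδ : 0 ≤ δ)
    (hD : ∀ i j, |D i j| ≤ δ) (x : Fin B → ℝ) (β : Fin r → ℝ) :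
    |2 * ∑ i, ∑ j, x i * β j * D i j| ≤ δ * (B * ∑ i, x i ^ 2 + r * ∑ j, β j ^ 2) := by
  have hx := sq_sum_le_card_mul_sum_sq (s := (univ : Finset (Fin B))) (f := fun i ↦ |x i|)
  have hb := sq_sum_le_card_mul_sum_sq (s := (univ : Finset (Fin r))) (f := fun j ↦ |β j|)
  simp only [card_univ, Fintype.card_fin, sq_abs] at hx hb
  have h1 : |∑ i, ∑ j, x i * β j * D i j| ≤ δ * ((∑ i, |x i|) * ∑ j, |β j|) := by
    calc |∑ i, ∑ j, x i * β j * D i j|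
        ≤ ∑ i, ∑ j, |x i| * |β j| * δ := by
          refine (abs_sum_le_sum_abs _ _).trans (sum_le_sum fun i _ ↦
            (abs_sum_le_sum_abs _ _).trans (sum_le_sum fun j _ ↦ ?_))
          rw [abs_mul, abs_mul]
          exact mul_le_mul_of_nonneg_left (hD i j) (by positivity)
      _ = δ * ((∑ i, |x i|) * ∑ j, |β j|) := by
          rw [sum_mul_sum, mul_sum]
          refine sum_congr rfl fun i _ ↦ ?_
          rw [mul_sum]
          exact sum_congr rfl fun j _ ↦ by ring
  have hS : 0 ≤ ∑ i, |x i| := sum_nonneg fun i _ ↦ abs_nonneg _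
  have hT : 0 ≤ ∑ j, |β j| := sum_nonneg fun j _ ↦ abs_nonneg _
  rw [abs_mul, abs_two]
  nlinarith [sq_nonneg ((∑ i, |x i|) - ∑ j, |β j|), h1, hx, hb,
    mul_nonneg hδ (sq_nonneg ((∑ i, |x i|) - ∑ j, |β j|))]

/-- **Two-block quadratic form with uniformly small entries.**  If `|D₁| , |D₂| , |D₃| ≤ δ` entrywise then
`|Σ x x D₁ + 2 Σ x β D₂ + Σ β β D₃| ≤ 2δ(B + r)(Σ x² + Σ β²)`. -/
theorem abs_blockQuadForm_le {B r : ℕ} {D₁ : Fin B → Fin B → ℝ} {D₂ : Fin B → Fin r → ℝ} {D₃ : Fin r → Fin r → ℝ}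
    {δ : ℝ} (hδ : 0 ≤ δ) (h₁ : ∀ i i', |D₁ i i'| ≤ δ) (h₂ : ∀ i j, |D₂ i j| ≤ δ) (h₃ : ∀ j j', |D₃ j j'| ≤ δ)
    (x : Fin B → ℝ) (β : Fin r → ℝ) :
    |(∑ i, ∑ i', x i * x i' * D₁ i i') + 2 * (∑ i, ∑ j, x i * β j * D₂ i j) + ∑ j, ∑ j', β j * β j' * D₃ j j'|
      ≤ 2 * δ * (B + r) * (∑ i, x i ^ 2 + ∑ j, β j ^ 2) := by
  have e1 := abs_sum_sum_mul_mul_le h₁ x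
  have e2 := abs_two_mul_sum_sum_mul_mul_le hδ h₂ x β
  have e3 := abs_sum_sum_mul_mul_le h₃ β
  have hx : 0 ≤ ∑ i, x i ^ 2 := sum_nonneg fun i _ ↦ sq_nonneg _
  have hb : 0 ≤ ∑ j, β j ^ 2 := sum_nonneg fun j _ ↦ sq_nonneg _
  calc |(∑ i, ∑ i', x i * x i' * D₁ i i') + 2 * (∑ i, ∑ j, x i * β j * D₂ i j) + ∑ j, ∑ j', β j * β j' * D₃ j j'|
      ≤ |∑ i, ∑ i', x i * x i' * D₁ i i'| + |2 * ∑ i, ∑ j, x i * β j * D₂ i j| +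
          |∑ j, ∑ j', β j * β j' * D₃ j j'| := abs_add_three _ _ _
    _ ≤ δ * B * ∑ i, x i ^ 2 + δ * (B * ∑ i, x i ^ 2 + r * ∑ j, β j ^ 2) + δ * r * ∑ j, β j ^ 2 :=
        add_le_add (add_le_add e1 e2) e3
    _ ≤ 2 * δ * (B + r) * (∑ i, x i ^ 2 + ∑ j, β j ^ 2) := by
        have hB : (0 : ℝ) ≤ B := Nat.cast_nonneg B
        have hr : (0 : ℝ) ≤ r := Nat.cast_nonneg r
        nlinarith [mul_nonneg hδ hB, mul_nonneg hδ hr, mul_nonneg (mul_nonneg hδ hB) hb,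
          mul_nonneg (mul_nonneg hδ hr) hx]

/-! ## Entrywise convergence ⟹ uniform approximation -/

/-- Finitely many convergent real sequences are eventually simultaneously `δ`-close to their limits. -/
theorem eventually_forall_abs_sub_le {ι : Type*} [Fintype ι] {f : ℕ → ι → ℝ} {g : ι → ℝ}
    (h : ∀ i, Tendsto (fun P ↦ f P i) atTop (𝓝 (g i))) {δ : ℝ} (hδ : 0 < δ) :
    ∀ᶠ P in atTop, ∀ i, |f P i - g i| ≤ δ := by
  refine eventually_all.2 fun i ↦ ?_
  have h' := (h i).sub_const (g i)
  rw [sub_self] at h'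
  have := (Metric.tendsto_nhds.1 h') δ hδ
  filter_upwards [this] with P hP
  rw [Real.dist_eq, sub_zero] at hP
  exact hP.le

/-- **Entrywise convergence gives the wrapper's uniform approximation.**  Let the `P`-dependent block entries
`A P i i'`, `C P i j`, `G P j j'` converge to `A∞ i i'`, `C∞ i j`, `G∞ j j'`.  Then for every `ε > 0` there is `P₀` such
that for all `P ≥ P₀` and all `(x, β)`:
`|(Σ x x A_P + 2Σ x β C_P + Σ β β G_P) − (Σ x x A∞ + 2Σ x β C∞ + Σ β β G∞)| ≤ ε(Σ x² + Σ β²)`. -/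
theorem exists_blockQuadForm_approx {B r : ℕ} {A : ℕ → Fin B → Fin B → ℝ} {C : ℕ → Fin B → Fin r → ℝ}
    {G : ℕ → Fin r → Fin r → ℝ} {A0 : Fin B → Fin B → ℝ} {C0 : Fin B → Fin r → ℝ} {G0 : Fin r → Fin r → ℝ}
    (hA : ∀ i i', Tendsto (fun P ↦ A P i i') atTop (𝓝 (A0 i i')))
    (hC : ∀ i j, Tendsto (fun P ↦ C P i j) atTop (𝓝 (C0 i j)))
    (hG : ∀ j j', Tendsto (fun P ↦ G P j j') atTop (𝓝 (G0 j j')))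
    {ε : ℝ} (hε : 0 < ε) :
    ∃ P₀ : ℕ, ∀ P, P₀ ≤ P → ∀ (x : Fin B → ℝ) (β : Fin r → ℝ),
      |((∑ i, ∑ i', x i * x i' * A P i i') + 2 * (∑ i, ∑ j, x i * β j * C P i j) + ∑ j, ∑ j', β j * β j' * G P j j')
        - ((∑ i, ∑ i', x i * x i' * A0 i i') + 2 * (∑ i, ∑ j, x i * β j * C0 i j) + ∑ j, ∑ j', β j * β j' * G0 j j')|
        ≤ ε * (∑ i, x i ^ 2 + ∑ j, β j ^ 2) := by
  -- the common entry tolerance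
  set δ : ℝ := ε / (2 * ((B : ℝ) + r) + 1) with hδdef
  have hden : 0 < 2 * ((B : ℝ) + r) + 1 := by positivity
  have hδ : 0 < δ := div_pos hε hden
  have hA' := eventually_forall_abs_sub_le (ι := Fin B × Fin B) (f := fun P p ↦ A P p.1 p.2) (g := fun p ↦ A0 p.1 p.2)
    (fun p ↦ hA p.1 p.2) hδ
  have hC' := eventually_forall_abs_sub_le (ι := Fin B × Fin r) (f := fun P p ↦ C P p.1 p.2) (g := fun p ↦ C0 p.1 p.2)
    (fun p ↦ hC p.1 p.2) hδ
  have hG' := eventually_forall_abs_sub_le (ι := Fin r × Fin r) (f := fun P p ↦ G P p.1 p.2) (g := fun p ↦ G0 p.1 p.2)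
    (fun p ↦ hG p.1 p.2) hδ
  obtain ⟨P₀, hP₀⟩ := eventually_atTop.1 ((hA'.and hC').and hG')
  refine ⟨P₀, fun P hP x β ↦ ?_⟩
  obtain ⟨⟨h1, h2⟩, h3⟩ := hP₀ P hP
  have key := abs_blockQuadForm_le (D₁ := fun i i' ↦ A P i i' - A0 i i') (D₂ := fun i j ↦ C P i j - C0 i j)
    (D₃ := fun j j' ↦ G P j j' - G0 j j') hδ.le (fun i i' ↦ h1 (i, i')) (fun i j ↦ h2 (i, j)) (fun j j' ↦ h3 (j, j')) x β
  have hxb : 0 ≤ ∑ i, x i ^ 2 + ∑ j, β j ^ 2 := by positivity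
  have hrew : ((∑ i, ∑ i', x i * x i' * A P i i') + 2 * (∑ i, ∑ j, x i * β j * C P i j) + ∑ j, ∑ j', β j * β j' * G P j j')
      - ((∑ i, ∑ i', x i * x i' * A0 i i') + 2 * (∑ i, ∑ j, x i * β j * C0 i j) + ∑ j, ∑ j', β j * β j' * G0 j j') =
      (∑ i, ∑ i', x i * x i' * (A P i i' - A0 i i')) + 2 * (∑ i, ∑ j, x i * β j * (C P i j - C0 i j)) +
        ∑ j, ∑ j', β j * β j' * (G P j j' - G0 j j') := by
    simp only [mul_sub, sum_sub_distrib]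
    ring
  rw [hrew]
  have hle : 2 * δ * ((B : ℝ) + r) ≤ ε := by
    have e : 2 * δ * ((B : ℝ) + r) = ε * (2 * ((B : ℝ) + r)) / (2 * ((B : ℝ) + r) + 1) := by
      rw [hδdef]; ring
    rw [e, div_le_iff₀ hden]
    nlinarith [hε]
  exact key.trans (mul_le_mul_of_nonneg_right hle hxb)

end Summit.RiemannHypothesis.RiemannHypothesis.Theorems.WeilFormatC
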